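/-
Origin: expansion seat `prover-pub-hodgecm-mc-sinst-1-g10-0`, handover #1251 2026-08-20T23:10Z md5 04d7d289246f (146 l.; NEW additive leaf, ns HodgeCM.Model.ThetaAdelicSide: satG_le_archSideOf_Gfin (hGfin DISCHARGED at archSideOf: S.Gfin = archFinOf V rfl + carch satLevelRegimeOf_le_archFinOf), exists_mem_holSatU_clsU_mem_block_archSideOf_zero / _one (= hfam clause 2 for every product-type theta form of slots 0/1 of the HONEST side, hypotheses: #CA61's Φarch/harm/hdef, E's hd/hCR (rows 14/15 currency) read on (lineOmega_k, Φarch), hι; hGfin AND hLF discharged at the term); imports #1250 + #1248 + Model/ArchKTypeOf + Model/ThetaAdelicSideLF; NAMES for audit: HodgeCM.Model.ThetaAdelicSide.satG_le_archSideOf_Gfin · HodgeCM.Model.ThetaAdelicSide.exists_mem_holSatU_clsU_mem_block_archSideOf_zero · HodgeCM.Model.ThetaAdelicSide.exists_mem_holSatU_clsU_mem_block_archSideOf_one) (`HOME/mc/pub-hodgecm-mc-sinst-1-g10/stage66/HodgeCM/Model/AdelicThetaDistributionEnd.lean`, md5 04d7d289246f, 146 lines);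
landed by the second packager p2 gen 15 (p2-g15) in gate run 66 as `HodgeCM/Model/AdelicThetaDistributionEnd.lean` (verbatim).
-/
/-
Copyright (c) 2026 the pub-hodgecm formalisation cell (harness21).  New file, not vendored.
Origin: session prover-pub-hodgecm-mc-sinst-1-g10-0 (unit pub-hodgecm-mc-sinst-1-g10, S-INSTANCE CONSTRUCTOR gen 10; the (J4) input of `hfam` AT THE
HONEST ADELIC SIDE `archSideOf …`: block membership of the tower classes of the product-type theta forms of slots 0/1), 2026-08-20.
Intended final place: `HodgeCM/Model/AdelicThetaDistributionEnd.lean` (NEW additive model-layer leaf; imports sinst-1's `Model/AdelicThetaDistributionOf`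
(#1250) and `Model/AdelicThetaDistributionBlock` (#1248), carch's `Model/ArchKTypeOf` (for `satLevelRegimeOf_le_archFinOf`), `Model/ThetaAdelicSideLF`
(for `isLFAction_archSideOf`); nothing imports it; drop alone).
-/
import Summits.HodgeConjecture.HodgeCM.Model.AdelicThetaDistributionOf
import Summits.HodgeConjecture.HodgeCM.Model.AdelicThetaDistributionBlock
import Summits.HodgeConjecture.HodgeCM.Model.ArchKTypeOf
import Summits.HodgeConjecture.HodgeCM.Model.ThetaAdelicSideLF

set_option autoImplicit false

/-!
# `hfam` clause 2 at the honest adelic side, slots 0 and 1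

For `S := archSideOf V c hGR hGR₀ hGR₁ hGR₂ hGR₃ η hη hηc h₁W A` and `D := thetaDistDatumZeroOf …` (resp. `OneOf`), the hypothesis
`hGfin : ∀ K, satLevelRegimeOf V hV K ≤ S.Gfin` of #1247/#1248 is DISCHARGED (`S.Gfin = archFinOf V` by `rfl`, carch `satLevelRegimeOf_le_archFinOf`)
and so is (LF) `hLF` (`isLFAction_archSideOf`, `Model/ThetaAdelicSideLF`), leaving, for the block membership of the tower class of
`θ(Φarch ℓ ⊗ Φ_f, charInv χ)`: the three archimedean inputs of #CA61 (`Φarch`, `harm`, `hdef`), E's (AN)/(REP′) `hd`/`hCR` read on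
`(lineOmega_k, Φarch)` (carch rows 14/15), and `hι` (`rfl` at the term, kept as the #1243 interface equation `S.ιinf = archInfOf V`).
KERNEL only: 0 records, 0 `def … : Prop`, nothing cited.
-/

noncomputable section

open NumberField.mixedEmbedding IsDedekindDomain MulAction
open NumberField hiding relNormOneIdeles relNormOneRat probHaarRelNormOneQuot
open scoped Matrix TensorProduct Classical SchwartzMap
open Literature.NumberTheory.Automorphic Literature.NumberTheory.Weil1964
open Literature.NumberTheory.GelbartRogawski1991 Literature.NumberTheory.GelbartRogawski1991.UnitaryDualPair
open Literature.Geometry.ComplexHyperbolic.BallModel (U21 x₀)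
open Literature.AlgebraicGeometry.HodgeTheory Literature.AlgebraicGeometry.ShimuraVarieties
open Literature.NumberTheory.Automorphic.PicardCM
open Literature.NumberTheory.Transcendental (Arapura2012_Cor_15_4_6)
open HodgeCM.Adelic HodgeCM.PerL34 HodgeCM.Model.ArchSideTerm HodgeCM.Model.ThetaDistFin HodgeCM.Model.TowerCarrier
open HodgeCM.Model.SupplyResidual.WeilPairData (charInv)

namespace HodgeCM.Model
namespace ThetaAdelicSide

variable (hHD : exists_isReal_hodgeModel) (hI : hodgePQ_independent_of_hodgeModel)
  (h₁ : BallQuotientUniformised) (h₃ : CMAbelianVarietyRealised) (hA : Arapura2012_Cor_15_4_6)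
variable {L : CMField} {ι₁ : L →+* ℂ} (V : HermSpace3 L ι₁) (c : SeesawCtx L)
  (hGR : (cmSplittingDatum (L : Type) finProdFinEquiv (frameD V) (frameD_real V) (frameD_ne V) (dW c.D) (dW_real c.D)
    (dW_ne c.D)).CompatibleSplitting)
  (hGR₀ : (cmSplittingDatum (L : Type) (e₁) (frameD V) (frameD_real V) (frameD_ne V) (lineVec (L : Type) (dW c.D 0))
    (fun _ => dW_real c.D 0) (fun _ => dW_ne c.D 0)).CompatibleSplitting)
  (hGR₁ : (cmSplittingDatum (L : Type) (e₁) (frameD V) (frameD_real V) (frameD_ne V) (lineVec (L : Type) (dW c.D 1))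
    (fun _ => dW_real c.D 1) (fun _ => dW_ne c.D 1)).CompatibleSplitting)
  (hGR₂ : (cmSplittingDatum (L : Type) (e₁) (frameD V) (frameD_real V) (frameD_ne V) (lineVec (L : Type) (dW' c.D 0))
    (fun _ => dW'_real c.D 0) (fun _ => dW'_ne c.D 0)).CompatibleSplitting)
  (hGR₃ : (cmSplittingDatum (L : Type) (e₁) (frameD V) (frameD_real V) (frameD_ne V) (lineVec (L : Type) (dW' c.D 1))
    (fun _ => dW'_real c.D 1) (fun _ => dW'_ne c.D 1)).CompatibleSplitting)
  (η : CMAdelic (L : Type) (frameD V) × CMAdelic (L : Type) (dW c.D) →* ℂˣ)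
  (hη : ∀ γU ∈ CMRat (L : Type) (frameD V), ∀ γ ∈ CMRat (L : Type) (dW c.D), η (γU, γ) = 1)
  (hηc : Continuous fun p => ((η p : ℂˣ) : ℂ))
  (h₁W : (∀ j, 0 < (ι₁ (dW c.D j)).re) ∨ ∀ j, (ι₁ (dW c.D j)).re < 0)
  (A : ∀ k : Fin 4, ArchLineInput V (lineRepD V c.D hGR hGR₀ hGR₁ hGR₂ hGR₃ η k))
  (hV : IsAnisotropic L V.Hm)

/-- `hGfin` at the term: the saturation group of every finite level lies in `(archSideOf …).Gfin = archFinOf V`. -/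
theorem satG_le_archSideOf_Gfin (K : Subgroup ↥V.adelicFin) :
    ThetaDistDatum.satG (V := V) hV K ≤ (archSideOf V c hGR hGR₀ hGR₁ hGR₂ hGR₃ η hη hηc h₁W A).Gfin :=
  satLevelRegimeOf_le_archFinOf V hV K

/-- **`hfam` clause 2 at the honest side, slot 0**: for every finite test vector `Φ_f` and every character `χ` whose `charInv χ` is a weight
function, the theta form `θ(Φarch ℓ ⊗ Φ_f, charInv χ)` of slot 0 of `archSideOf …` lies in `holSatU` and its tower class lies in the block of the
slot's Liu module `Ω(χ) = (D.coinvRep χ).asModule`, `D := thetaDistDatumZeroOf …`. -/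
theorem exists_mem_holSatU_clsU_mem_block_archSideOf_zero
    (Φarch : Module.Dual ℂ (Fin 2 → ℂ) →ₗ[ℂ] 𝓢((Fin 3 → mixedSpace (↥(maximalRealSubfield L))), ℂ))
    (harm : ∀ (u : ↥(stabilizer U21 x₀)) (ℓ : Module.Dual ℂ (Fin 2 → ℂ)),
      lineOmega_zero V c.D hGR hGR₀ hGR₁ (eta₀ V c.D η) (u : U21) (Φarch ℓ) =
        Φarch ((BallForms.isPullbackCocycle_cotangentCocycle.weightOf x₀).dual u ℓ))
    (hdef : ∀ a : UnitaryGroup.arch (↥(maximalRealSubfield L)) L (IsCMField.complexConj L) 3 V.Hm,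
      UnitaryGroup.archAt (↥(maximalRealSubfield L)) L (IsCMField.complexConj L) 3 V.Hm (UnitaryGroup.cmPlace (L : Type) ι₁)
          (NumberField.complexConj_smul_infinitePlace (L : Type) _) (IsCMField.complexConj_ne_one (L : Type)) a = 1 →
      ∀ (ℓ : Module.Dual ℂ (Fin 2 → ℂ)) (Φf : FinSB (↥(maximalRealSubfield L)) (Fin 3)),
        lineRepOf V c.D hGR hGR₀ hGR₁ hGR₂ hGR₃ (eta₀ V c.D η) (eta₁ V c.D η) (eta₂ V c.D η) (eta₃ V c.D η) 0
            (HodgeCM.Adelic.regimeEquiv L V.Hm hV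
              (UnitaryGroup.archToAdelic (↥(maximalRealSubfield L)) L (IsCMField.complexConj L) 3 V.Hm a), 1)
            (piSchwartzBruhatEquiv (↥(maximalRealSubfield L)) (Fin 3) (Φarch ℓ ⊗ₜ[ℂ] Φf)) =
          piSchwartzBruhatEquiv (↥(maximalRealSubfield L)) (Fin 3) (Φarch ℓ ⊗ₜ[ℂ] Φf))
    (hd : ∀ (T : 𝓢((Fin 3 → mixedSpace (↥(maximalRealSubfield L))), ℂ) →L[ℂ] ℂ) (ℓ : Module.Dual ℂ (Fin 2 → ℂ)),
      DifferentiableAt ℝ (fun b => T (lineOmega_zero V c.D hGR hGR₀ hGR₁ (eta₀ V c.D η) (BallForms.expP b) (Φarch ℓ))) 0)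
    (hCR : ∀ (T : 𝓢((Fin 3 → mixedSpace (↥(maximalRealSubfield L))), ℂ) →L[ℂ] ℂ) (ℓ : Module.Dual ℂ (Fin 2 → ℂ)) (v : Fin 2 → ℂ),
      fderiv ℝ (fun b => T (lineOmega_zero V c.D hGR hGR₀ hGR₁ (eta₀ V c.D η) (BallForms.expP b) (Φarch ℓ))) 0 (Complex.I • v) =
        Complex.I • fderiv ℝ (fun b => T (lineOmega_zero V c.D hGR hGR₀ hGR₁ (eta₀ V c.D η) (BallForms.expP b) (Φarch ℓ))) 0 v)
    {𝓕 : Set C(↥(relNormOneIdeles (↥(maximalRealSubfield L)) L) ⧸ relNormOneRat (↥(maximalRealSubfield L)) L, ℂ)}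
    (χ : PontryaginDual (↥(relNormOneIdeles (↥(maximalRealSubfield L)) L) ⧸ relNormOneRat (↥(maximalRealSubfield L)) L))
    (hχ : charInv χ ∈ 𝓕) (hι : (archSideOf V c hGR hGR₀ hGR₁ hGR₂ hGR₃ η hη hηc h₁W A).ιinf = archInfOf V)
    (Φf : FinSB (↥(maximalRealSubfield L)) (Fin 3)) :
    ∃ hF : (thetaDistDatumZeroOf V c hGR hGR₀ hGR₁ hGR₂ hGR₃ η hη hηc h₁W A hV Φarch harm hdef).dist (charInv χ) Φf ∈
        (archSideOf V c hGR hGR₀ hGR₁ hGR₂ hGR₃ η hη hηc h₁W A).holSatU hV 0 𝓕,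
      (archSideOf V c hGR hGR₀ hGR₁ hGR₂ hGR₃ η hη hηc h₁W A).clsU hHD hI h₁ h₃ hA 𝓕 hι hV 0
          ⟨(thetaDistDatumZeroOf V c hGR hGR₀ hGR₁ hGR₂ hGR₃ η hη hηc h₁W A hV Φarch harm hdef).dist (charInv χ) Φf, hF⟩ ∈
        ⨆ ψ : ((thetaDistDatumZeroOf V c hGR hGR₀ hGR₁ hGR₂ hGR₃ η hη hηc h₁W A hV Φarch harm hdef).coinvRep χ).asModule
            →ₗ[MonoidAlgebra ℂ ↥V.adelicFin] Tower hHD hI (ballQuotientUniformisedDatum_of h₁) h₃ hA V,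
          (LinearMap.range ψ).restrictScalars ℂ :=
  (thetaDistDatumZeroOf V c hGR hGR₀ hGR₁ hGR₂ hGR₃ η hη hηc h₁W A hV Φarch harm hdef).exists_mem_holSatU_clsU_mem_block hHD hI h₁ h₃ hA
    (satG_le_archSideOf_Gfin V c hGR hGR₀ hGR₁ hGR₂ hGR₃ η hη hηc h₁W A hV)
    (isLFAction_archSideOf V c hGR hGR₀ hGR₁ hGR₂ hGR₃ η hη hηc h₁W A 0) hd hCR χ hχ hι Φf

/-- **`hfam` clause 2 at the honest side, slot 1**: for every finite test vector `Φ_f` and every character `χ` whose `charInv χ` is a weight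
function, the theta form `θ(Φarch ℓ ⊗ Φ_f, charInv χ)` of slot 1 of `archSideOf …` lies in `holSatU` and its tower class lies in the block of the
slot's Liu module `Ω(χ) = (D.coinvRep χ).asModule`, `D := thetaDistDatumOneOf …`. -/
theorem exists_mem_holSatU_clsU_mem_block_archSideOf_one
    (Φarch : Module.Dual ℂ (Fin 2 → ℂ) →ₗ[ℂ] 𝓢((Fin 3 → mixedSpace (↥(maximalRealSubfield L))), ℂ))
    (harm : ∀ (u : ↥(stabilizer U21 x₀)) (ℓ : Module.Dual ℂ (Fin 2 → ℂ)),
      lineOmega_one V c.D hGR hGR₀ hGR₁ (eta₁ V c.D η) (u : U21) (Φarch ℓ) =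
        Φarch ((BallForms.isPullbackCocycle_cotangentCocycle.weightOf x₀).dual u ℓ))
    (hdef : ∀ a : UnitaryGroup.arch (↥(maximalRealSubfield L)) L (IsCMField.complexConj L) 3 V.Hm,
      UnitaryGroup.archAt (↥(maximalRealSubfield L)) L (IsCMField.complexConj L) 3 V.Hm (UnitaryGroup.cmPlace (L : Type) ι₁)
          (NumberField.complexConj_smul_infinitePlace (L : Type) _) (IsCMField.complexConj_ne_one (L : Type)) a = 1 →
      ∀ (ℓ : Module.Dual ℂ (Fin 2 → ℂ)) (Φf : FinSB (↥(maximalRealSubfield L)) (Fin 3)),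
        lineRepOf V c.D hGR hGR₀ hGR₁ hGR₂ hGR₃ (eta₀ V c.D η) (eta₁ V c.D η) (eta₂ V c.D η) (eta₃ V c.D η) 1
            (HodgeCM.Adelic.regimeEquiv L V.Hm hV
              (UnitaryGroup.archToAdelic (↥(maximalRealSubfield L)) L (IsCMField.complexConj L) 3 V.Hm a), 1)
            (piSchwartzBruhatEquiv (↥(maximalRealSubfield L)) (Fin 3) (Φarch ℓ ⊗ₜ[ℂ] Φf)) =
          piSchwartzBruhatEquiv (↥(maximalRealSubfield L)) (Fin 3) (Φarch ℓ ⊗ₜ[ℂ] Φf))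
    (hd : ∀ (T : 𝓢((Fin 3 → mixedSpace (↥(maximalRealSubfield L))), ℂ) →L[ℂ] ℂ) (ℓ : Module.Dual ℂ (Fin 2 → ℂ)),
      DifferentiableAt ℝ (fun b => T (lineOmega_one V c.D hGR hGR₀ hGR₁ (eta₁ V c.D η) (BallForms.expP b) (Φarch ℓ))) 0)
    (hCR : ∀ (T : 𝓢((Fin 3 → mixedSpace (↥(maximalRealSubfield L))), ℂ) →L[ℂ] ℂ) (ℓ : Module.Dual ℂ (Fin 2 → ℂ)) (v : Fin 2 → ℂ),
      fderiv ℝ (fun b => T (lineOmega_one V c.D hGR hGR₀ hGR₁ (eta₁ V c.D η) (BallForms.expP b) (Φarch ℓ))) 0 (Complex.I • v) =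
        Complex.I • fderiv ℝ (fun b => T (lineOmega_one V c.D hGR hGR₀ hGR₁ (eta₁ V c.D η) (BallForms.expP b) (Φarch ℓ))) 0 v)
    {𝓕 : Set C(↥(relNormOneIdeles (↥(maximalRealSubfield L)) L) ⧸ relNormOneRat (↥(maximalRealSubfield L)) L, ℂ)}
    (χ : PontryaginDual (↥(relNormOneIdeles (↥(maximalRealSubfield L)) L) ⧸ relNormOneRat (↥(maximalRealSubfield L)) L))
    (hχ : charInv χ ∈ 𝓕) (hι : (archSideOf V c hGR hGR₀ hGR₁ hGR₂ hGR₃ η hη hηc h₁W A).ιinf = archInfOf V)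
    (Φf : FinSB (↥(maximalRealSubfield L)) (Fin 3)) :
    ∃ hF : (thetaDistDatumOneOf V c hGR hGR₀ hGR₁ hGR₂ hGR₃ η hη hηc h₁W A hV Φarch harm hdef).dist (charInv χ) Φf ∈
        (archSideOf V c hGR hGR₀ hGR₁ hGR₂ hGR₃ η hη hηc h₁W A).holSatU hV 1 𝓕,
      (archSideOf V c hGR hGR₀ hGR₁ hGR₂ hGR₃ η hη hηc h₁W A).clsU hHD hI h₁ h₃ hA 𝓕 hι hV 1
          ⟨(thetaDistDatumOneOf V c hGR hGR₀ hGR₁ hGR₂ hGR₃ η hη hηc h₁W A hV Φarch harm hdef).dist (charInv χ) Φf, hF⟩ ∈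
        ⨆ ψ : ((thetaDistDatumOneOf V c hGR hGR₀ hGR₁ hGR₂ hGR₃ η hη hηc h₁W A hV Φarch harm hdef).coinvRep χ).asModule
            →ₗ[MonoidAlgebra ℂ ↥V.adelicFin] Tower hHD hI (ballQuotientUniformisedDatum_of h₁) h₃ hA V,
          (LinearMap.range ψ).restrictScalars ℂ :=
  (thetaDistDatumOneOf V c hGR hGR₀ hGR₁ hGR₂ hGR₃ η hη hηc h₁W A hV Φarch harm hdef).exists_mem_holSatU_clsU_mem_block hHD hI h₁ h₃ hA
    (satG_le_archSideOf_Gfin V c hGR hGR₀ hGR₁ hGR₂ hGR₃ η hη hηc h₁W A hV)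
    (isLFAction_archSideOf V c hGR hGR₀ hGR₁ hGR₂ hGR₃ η hη hηc h₁W A 1) hd hCR χ hχ hι Φf

end ThetaAdelicSide
end HodgeCM.Model

end
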